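import Literature.AlgebraicGeometry.AbelianSchemes.CoverKerBaseChangeAlongBaseIso           -- ★ p849526 (mine) the cover-ker shape base-changes along `e : Spec Ω′ → Spec Ω`
import Literature.AlgebraicGeometry.AbelianSchemes.PointsTransferRestrictPtBaseChangeComp    -- ★ p849541 (mine) the `hpt` junction of the re-index step
import Literature.AlgebraicGeometry.AbelianSchemes.TupleIsoPointCriteria                    -- ★ `exists_iso_of_tupleRel_id`; re-exports ★ `tupleRel_baseChangeCompGrpIso_inv`
import HarnessLib

/-!
# The Serre cover (with kernel clause) of a PEL FAMILY read at two `Ω`-points `ℓ₁, ℓ₂` moves to the cover read at the points `x ≫ ℓ₁, x ≫ ℓ₂` for ANY `x : Spec Ω′ → Spec Ω`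

Topic `AlgebraicGeometry/AbelianSchemes`; namespace `Literature.AlgebraicGeometry.AbelianSchemes.AbelianSchemeOver`.  THEOREMS ONLY (no definition,
no named fact, no instance, no notation, no `sorry`).  Cell `hodgecm-mathlib` (D-0151), P6 «MOD programme» (crux hLiu418 = stmt-HodgeConjecture-24832,
`--supports`, count-neutral), line «L4», X-LEAF `Lines/F0_P6a_EExports.lean` (A-p01 (g28)) socket `stub_ECtoΩ` «transport of the E-readings `CoverKerE`∕`CoverE`
((K-law)∕(cover) rows of `ETwistKerAt`) from `ℂ`-points to `F̄_w`-points along a ring isomorphism `σ : F̄_w ≃ ℂ` over `ι₁`» (LA4-plan (g0) DEAL #20′ (ii),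
cover half; assembly LA4-p03 (g2)).  THE ONE-CALL FORM, in the BODY CURRENCY of the E-readings (`schEOf = 𝒜.baseChange ℓ`, `actEOf a = fibreHom (ρ.i a) ℓ` whose
underlying morphism is `baseChangeHom (ρ.i a) ℓ` by `rfl` (★ `fibreHom_hom_hom_hom`), `dualEOf = D.baseChange ℓ`, `polEOf = pol.baseChange ℓ`,
`lvlPtEOf a = 𝒜.restrictPt ℓ (lvl.section_ a)`, `ℓ = thickeningLift e X y`): the seven-clause cover-with-kernel-clause shape of ONE PEL family
`(𝒜, ι, (Â, 𝒫), λ, lvl)` over `Y` read at two `Ω`-points `ℓ₁, ℓ₂ : Spec Ω → Y` yields the same shape read at `x ≫ ℓ₁, x ≫ ℓ₂ : Spec Ω′ → Y` for every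
`x : Spec Ω′ → Spec Ω` (no isomorphism hypothesis) — so the X-leaf's `stub_ECtoΩ` (cover rows) is THIS head at `x := Spec σ` followed by the two-field law
`ℓ_{σ̃ ∘ e}(σ̃ • y) = x ≫ ℓ_e(y)` (LA4-p01 (g2)∕A-p01 (g28) core, not restated here).
HC_CM is proved only modulo the 2 remaining named inputs (hLiu418 24832, h413 24833) until rung 0 closes; nothing here is about HC.

THE MATHEMATICS ([GortzWedhorn2020] (4.7), Prop. 4.16; [MumfordFogartyKirwan1994] Ch. 6 §1 Cor. 6.4∕6.8, Ch. 7 §2 Def. 7.2–7.3; [Shimura1998] §13.1 Thm. 1 ∕ §18.6: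
the Serre `𝔞`-transform between CM fibres and all its structure maps are compatible with extension of the field of definition of the point).  Three ★ steps:
(1) base change of the shape along `x` for the tuples `𝒜 ×_Y ℓᵢ` over `Spec Ω`, the level points moved by transfers (★ `coverKer_baseChange_of_transfer`,
★ `exists_pointsTransfer`); (2) the comparison `(𝒜 ×_Y ℓᵢ) ×_Ω Spec Ω′ ≅ 𝒜 ×_Y (x ≫ ℓᵢ)` IS a six-clause relation along `𝟙 (Spec Ω′)` (★
`tupleRel_baseChangeCompGrpIso_inv`), hence an isomorphism of group schemes EXACT on `λ` (dual-homomorphism form), on the `𝒪`-action and on the level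
sections (★ `exists_iso_of_tupleRel_id`, over the reduced Noetherian `Spec Ω′`, Poincaré pins from the family's `(1 × ε_Â)^*𝒫 ≅ 𝒪` by ★
`DualPair.nonempty_unitHatSlice_baseChange_iso`); (3) transport of the shape along these exact isomorphisms (★ `coverKer_transport_along_iso`), the point
hypothesis `hpt` being ★ `map_pointsTransfer_restrictPt_of_left_eq_baseChangeCompGrpIso_inv`.

* **`coverKer_readAt_comp`** — THE HEAD (with kernel clause (t1′); readers `baseChangeHom (ρ.i a) ℓ`, `(pol.baseChange ℓ).lam`, `D.baseChange ℓ`,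
  `𝒜.restrictPt ℓ (lvl.section_ a)`; abstract `𝔞 𝔟 : O → Prop`, `ν : O`, `N : ℕ`).

## References
* [GortzWedhorn2020] U. Görtz, T. Wedhorn, *Algebraic Geometry I*, 2nd ed. (2020), Section (4.7) (pp. 107–108), Prop. 4.16 (p. 101).
* [MumfordFogartyKirwan1994] D. Mumford, J. Fogarty, F. Kirwan, *Geometric Invariant Theory*, 3rd ed. (1994), Ch. 6 §1 Cor. 6.4 (p. 117), Cor. 6.8 (p. 118); Ch. 7 §2 Def. 7.2 (p. 129), Def. 7.3 (p. 130).
* [Shimura1998] G. Shimura, *Abelian Varieties with Complex Multiplication and Modular Functions* (1998), §13.1 Theorem 1 (pp. 97–99), §18.6 (pp. 124–127).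
* [MilneAV2008] J. S. Milne, *Abelian Varieties* (2008), I §8 pp. 36–37 (the dual transport is forced).
* [MumfordAV1970] D. Mumford, *Abelian Varieties* (1970), §15 Thm. 1 (p. 143).
-/

set_option autoImplicit false

noncomputable section

-- Mathlib's `Over`/pull-back API is stated across semireducible wrappers (as in the ★ `AbelianSchemes/*` files).
set_option backward.isDefEq.respectTransparency false

universe u

open CategoryTheory CategoryTheory.Limits AlgebraicGeometry MonoidalCategory
open scoped MonObj Obj

namespace Literature.AlgebraicGeometry.AbelianSchemes

namespace AbelianSchemeOver

open Literature.AlgebraicGeometry.Motives (AlgPoints specOver)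

section ReadAt

variable {Y : Scheme.{u}} (𝒜 : AbelianSchemeOver Y) {O : Type*} [CommRing O] (ρ : RingAction O 𝒜) (D : 𝒜.DualPair)
  (hD : Nonempty ((Scheme.Modules.pullback D.unitHatSlice).obj D.P ≅ SheafOfModules.unit _))
  (pol : 𝒜.Polarization D) {g n : ℕ} (lvl : 𝒜.LevelStructure g n)
  {Ω Ω' : Type u} [Field Ω] [Field Ω'] (ℓ₁ ℓ₂ : Spec (.of Ω) ⟶ Y) (x : Spec (.of Ω') ⟶ Spec (.of Ω))
  (𝔞 𝔟 : O → Prop) (ν : O) (N : ℕ)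

include hD in
/-- **THE SERRE COVER WITH ITS KERNEL CLAUSE, READ AT `(ℓ₁, ℓ₂)`, MOVES TO `(x ≫ ℓ₁, x ≫ ℓ₂)`** — see the module docstring.  Input∕output clause texts = the E-reading
`CoverKerE` ((t1) Serre presentation of `𝔞`, (t1′) kernel clause on all `T`-points, (t2) upper bound through `𝔟` and `ν`, (t3) `c ≫ λ₂ ≫ c^∨ = λ₁ ≫ [N]`, (t4)
`ι`-equivariance, (t5) level points `σᵃ`) with the readers of ONE family `(𝒜, ρ, D, pol, lvl)` at the two points spelled in their ★ bodies (`baseChangeHom (ρ.i a) ℓ =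
(fibreHom (ρ.i a) ℓ).hom.hom.hom` by `rfl`); `hD` is the Poincaré normalisation `(1 × ε_Â)^*𝒫 ≅ 𝒪` of the family (for a ★ `PolarizedAbelianSchemeWithLevel`: its
`hatNormalised`).  No hypothesis on `x`. [cite: MumfordFogartyKirwan1994, Ch. 7 §2 Definition 7.2 (p. 129) and Definition 7.3 (p. 130)]
[cite: GortzWedhorn2020, Section (4.7) (pp. 107–108) and Prop. 4.16 (p. 101)] [cite: Shimura1998, §13.1 Theorem 1 (pp. 97–99); §18.6 (pp. 124–127)]
[cite: MilneAV2008, I §8 pp. 36–37] -/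
theorem coverKer_readAt_comp
    (hcover : ∃ (c : (𝒜.baseChange ℓ₁).X ⟶ (𝒜.baseChange ℓ₂).X) (_ : IsMonHom c),
        (∀ a, 𝔞 a → ∃ d : (𝒜.baseChange ℓ₂).X ⟶ (𝒜.baseChange ℓ₁).X,
          c ≫ d = baseChangeHom (ρ.i a) ℓ₁ ∧ d ≫ c = baseChangeHom (ρ.i a) ℓ₂) ∧
        (∀ ⦃T : Literature.AlgebraicGeometry.Motives.SchemeOver Ω⦄ (t : T ⟶ (𝒜.baseChange ℓ₁).X),
          t ≫ c = 1 ↔ ∀ a, 𝔞 a → t ≫ baseChangeHom (ρ.i a) ℓ₁ = 1) ∧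
        (∀ b, 𝔟 b → ∃ f : (𝒜.baseChange ℓ₁).X ⟶ (𝒜.baseChange ℓ₂).X,
          c ≫ baseChangeHom (ρ.i b) ℓ₂ = f ≫ baseChangeHom (ρ.i ν) ℓ₂) ∧
        c ≫ (pol.baseChange ℓ₂).lam ≫ DualPair.dualIsogenyOver c (D.baseChange ℓ₁) (D.baseChange ℓ₂) =
          (pol.baseChange ℓ₁).lam ≫ (D.baseChange ℓ₁).hat.mulN N ∧
        (∀ a, baseChangeHom (ρ.i a) ℓ₁ ≫ c = c ≫ baseChangeHom (ρ.i a) ℓ₂) ∧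
        (∀ a : Fin g ⊕ Fin g → ZMod n,
          (AlgPoints.map c (𝒜.restrictPt ℓ₁ (lvl.section_ a)) : (𝒜.baseChange ℓ₂).toAffine.toAbelianVariety.Points Ω) =
            𝒜.restrictPt ℓ₂ (lvl.section_ a))) :
    ∃ (c : (𝒜.baseChange (x ≫ ℓ₁)).X ⟶ (𝒜.baseChange (x ≫ ℓ₂)).X) (_ : IsMonHom c),
        (∀ a, 𝔞 a → ∃ d : (𝒜.baseChange (x ≫ ℓ₂)).X ⟶ (𝒜.baseChange (x ≫ ℓ₁)).X,
          c ≫ d = baseChangeHom (ρ.i a) (x ≫ ℓ₁) ∧ d ≫ c = baseChangeHom (ρ.i a) (x ≫ ℓ₂)) ∧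
        (∀ ⦃T : Literature.AlgebraicGeometry.Motives.SchemeOver Ω'⦄ (t : T ⟶ (𝒜.baseChange (x ≫ ℓ₁)).X),
          t ≫ c = 1 ↔ ∀ a, 𝔞 a → t ≫ baseChangeHom (ρ.i a) (x ≫ ℓ₁) = 1) ∧
        (∀ b, 𝔟 b → ∃ f : (𝒜.baseChange (x ≫ ℓ₁)).X ⟶ (𝒜.baseChange (x ≫ ℓ₂)).X,
          c ≫ baseChangeHom (ρ.i b) (x ≫ ℓ₂) = f ≫ baseChangeHom (ρ.i ν) (x ≫ ℓ₂)) ∧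
        c ≫ (pol.baseChange (x ≫ ℓ₂)).lam ≫ DualPair.dualIsogenyOver c (D.baseChange (x ≫ ℓ₁)) (D.baseChange (x ≫ ℓ₂)) =
          (pol.baseChange (x ≫ ℓ₁)).lam ≫ (D.baseChange (x ≫ ℓ₁)).hat.mulN N ∧
        (∀ a, baseChangeHom (ρ.i a) (x ≫ ℓ₁) ≫ c = c ≫ baseChangeHom (ρ.i a) (x ≫ ℓ₂)) ∧
        (∀ a : Fin g ⊕ Fin g → ZMod n,
          (AlgPoints.map c (𝒜.restrictPt (x ≫ ℓ₁) (lvl.section_ a)) : (𝒜.baseChange (x ≫ ℓ₂)).toAffine.toAbelianVariety.Points Ω') =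
            𝒜.restrictPt (x ≫ ℓ₂) (lvl.section_ a)) := by
  classical
  -- (1) base change along `x`, the level points moved by transfers
  obtain ⟨ε₁, hε₁⟩ := exists_pointsTransfer x (𝒜.baseChange ℓ₁)
  obtain ⟨ε₂, hε₂⟩ := exists_pointsTransfer x (𝒜.baseChange ℓ₂)
  have hbc := coverKer_baseChange_of_transfer x (D.baseChange ℓ₁) (D.baseChange ℓ₂) (pol.baseChange ℓ₁).lam (pol.baseChange ℓ₂).lam
    (fun a => baseChangeHom (ρ.i a) ℓ₁) (fun a => baseChangeHom (ρ.i a) ℓ₂)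
    (fun a : Fin g ⊕ Fin g → ZMod n => (𝒜.restrictPt ℓ₁ (lvl.section_ a) : (𝒜.baseChange ℓ₁).toAffine.toAbelianVariety.Points Ω))
    (fun a : Fin g ⊕ Fin g → ZMod n => (𝒜.restrictPt ℓ₂ (lvl.section_ a) : (𝒜.baseChange ℓ₂).toAffine.toAbelianVariety.Points Ω))
    𝔞 𝔟 ν N hε₁ hε₂ (fun a => ε₁ (𝒜.restrictPt ℓ₁ (lvl.section_ a))) (fun a => ε₂ (𝒜.restrictPt ℓ₂ (lvl.section_ a)))
    (fun _ => rfl) (fun _ => rfl) hcover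
  -- the Poincaré pins of all the base-changed dual pairs
  have hD₁ := DualPair.nonempty_unitHatSlice_baseChange_iso (g := x) (D.baseChange ℓ₁) (DualPair.nonempty_unitHatSlice_baseChange_iso (g := ℓ₁) D hD)
  have hD₁' := DualPair.nonempty_unitHatSlice_baseChange_iso (g := x) (D.baseChange ℓ₂) (DualPair.nonempty_unitHatSlice_baseChange_iso (g := ℓ₂) D hD)
  have hD₂ := DualPair.nonempty_unitHatSlice_baseChange_iso (g := x ≫ ℓ₁) D hD
  have hD₂' := DualPair.nonempty_unitHatSlice_baseChange_iso (g := x ≫ ℓ₂) D hD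
  -- (2) the exact comparison isomorphisms `(𝒜 ×_Y ℓᵢ) ×_Ω Spec Ω′ ≅ 𝒜 ×_Y (x ≫ ℓᵢ)`
  obtain ⟨e₁, he₁mon, he₁left, -, he₁lam, he₁σ, he₁act⟩ := exists_iso_of_tupleRel_id ((D.baseChange ℓ₁).baseChange x) (D.baseChange (x ≫ ℓ₁))
    (baseChangeHom (pol.baseChange ℓ₁).lam x) (pol.baseChange (x ≫ ℓ₁)).lam hD₂ ((lvl.baseChange ℓ₁).baseChange x) (lvl.baseChange (x ≫ ℓ₁))
    (fun a => baseChangeHom (baseChangeHom (ρ.i a) ℓ₁) x) (fun a => baseChangeHom (ρ.i a) (x ≫ ℓ₁))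
    (tupleRel_baseChangeCompGrpIso_inv 𝒜 ρ D pol lvl ℓ₁ x)
  obtain ⟨e₂, he₂mon, he₂left, -, he₂lam, he₂σ, he₂act⟩ := exists_iso_of_tupleRel_id ((D.baseChange ℓ₂).baseChange x) (D.baseChange (x ≫ ℓ₂))
    (baseChangeHom (pol.baseChange ℓ₂).lam x) (pol.baseChange (x ≫ ℓ₂)).lam hD₂' ((lvl.baseChange ℓ₂).baseChange x) (lvl.baseChange (x ≫ ℓ₂))
    (fun a => baseChangeHom (baseChangeHom (ρ.i a) ℓ₂) x) (fun a => baseChangeHom (ρ.i a) (x ≫ ℓ₂))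
    (tupleRel_baseChangeCompGrpIso_inv 𝒜 ρ D pol lvl ℓ₂ x)
  haveI := he₁mon
  haveI := he₂mon
  -- (3) transport along the exact isomorphisms; the point hypothesis is the re-index junction
  exact coverKer_transport_along_iso ((D.baseChange ℓ₁).baseChange x) (D.baseChange (x ≫ ℓ₁)) ((D.baseChange ℓ₂).baseChange x) (D.baseChange (x ≫ ℓ₂))
    hD₁ hD₂ hD₁' hD₂' (baseChangeHom (pol.baseChange ℓ₁).lam x) (pol.baseChange (x ≫ ℓ₁)).lam (baseChangeHom (pol.baseChange ℓ₂).lam x) (pol.baseChange (x ≫ ℓ₂)).lam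
    (fun a => baseChangeHom (baseChangeHom (ρ.i a) ℓ₁) x) (fun a => baseChangeHom (ρ.i a) (x ≫ ℓ₁))
    (fun a => baseChangeHom (baseChangeHom (ρ.i a) ℓ₂) x) (fun a => baseChangeHom (ρ.i a) (x ≫ ℓ₂))
    (fun a => ε₁ (𝒜.restrictPt ℓ₁ (lvl.section_ a))) (fun a => 𝒜.restrictPt (x ≫ ℓ₁) (lvl.section_ a))
    (fun a => ε₂ (𝒜.restrictPt ℓ₂ (lvl.section_ a))) (fun a => 𝒜.restrictPt (x ≫ ℓ₂) (lvl.section_ a))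
    𝔞 𝔟 ν e₁ e₂ N he₁lam he₂lam he₁act he₂act
    (fun a => 𝒜.map_pointsTransfer_restrictPt_of_left_eq_baseChangeCompGrpIso_inv ℓ₁ x hε₁ e₁.hom he₁left (lvl.section_ a))
    (fun a => 𝒜.map_pointsTransfer_restrictPt_of_left_eq_baseChangeCompGrpIso_inv ℓ₂ x hε₂ e₂.hom he₂left (lvl.section_ a))
    hbc

end ReadAt

end AbelianSchemeOver

end Literature.AlgebraicGeometry.AbelianSchemes

end
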